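import Literature.MathematicalPhysics.QuantumFieldTheory.Balaban1983to89.B9B8KnitAveragingClosenessAtCorner
import Literature.MathematicalPhysics.QuantumFieldTheory.Balaban1983to89.B9B8KnitVsTaxicab

/-!
# `Balaban1983to89.B9B8KnitAveragingClosenessAtCentre` — the (B)-line bond junction, file F4: THE AVERAGING HYPOTHESIS `hQQ` AT PRINT's CENTRE-TAXICAB
# TRANSPORTER FAMILY `parBY`, PER BACKGROUND (the corner-tree `hQQ` of F3 transported to the block centres at the cost `O(α)`)

statement-level skeleton of published theorems with citation tags; proofs where landed; nothing here is a claim about the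
Yang–Mills mass gap

Sub-row G-B8-T2S (unit `lit-balaban-t2s-1`, gen 8), RULING #10 road, crux (c′), file F4 of the ruling 2026-08-28 18:25Z.  File F3
(`B9B8KnitAveragingClosenessAtCorner.hQQ_cornerTree_bgY`) supplies the displayed averaging hypothesis `hQQ` of the torus socket at the CORNER-TREE transporter
family (`qT ι b = U♯(Γ^{tree}_{x₀→b₋})`, `x₀` the corner of the block of `ι`), whereas def-Y's letters of record — `parBY` ([4] (3.12): «U(Γ_{y,x}) … Γ a contour
from the centre y of the block», (3.40): «a shortest contour»; `Node00.OpsYTransport.parBY = parTaxiV`) and the suppliers typed at it (`B9Cor36GCubeAtLocCfg`,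
`B9Cor36GCubeCutoffsB`, `B9Eq383CubeLetters`) — transport from the block CENTRE along the taxicab contour.  The two transporters differ by
`W_ι(b)·T_ι` with `T_ι = U(Γ^{taxi}_{c→x₀})` INDEPENDENT of the fine bond and `W_ι(b) = U(c →taxi→ b₋ →tree⁻¹→ x₀ →taxi⁻¹→ c)` the holonomy of a closed contour of
length `≤ 4(d+2)Lⁿ` inside `Bⁿ(ι₋) ∪ Bⁿ(ι₊)`; in the corner axial gauge ([5] pp. 24–25: every bond variable of the double block within `(d+2)αL^{−n}` of `1`)
`‖W_ι(b) − 1‖ ≤ 4(d+2)²α`.  The sandwich `Q*(U)aQ(U)` is EXACTLY invariant under the bond-independent re-basing `T_ι` (F3 §5 `QsY_aY_QY_rebase`, `a` diagonal) and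
moves by `≤ 8ε·c_f²L^{−2n}·‖a‖` per fine bond under an `ε`-re-basing (§4: `‖R(V)X − X‖ ≤ 2‖V − 1‖‖X‖`, total mass one of the weights of an index bond, two index
bonds per fine bond at constant level, `|qK|·w ≤ c_f²L^{−2n}`).  Hence `hQQ` at `parBY` with
`ε_Q = (w₋₃∕w₋₁)·(32(d+2)²·c_f²L^{−2n}·α + ε_F3)`, `ε_F3 = (c_fη)²·w_n·2(d+1)·C_τβ_τ·6(d+1)·K₁·η·Lⁿ·LⁿL^{−n(d+1)}·α` — linear in the regularity `α` of (1.7).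
Print: [4] (3.3), (3.8) pp. 391–392, (3.12)–(3.13) pp. 392–393, (3.16) p. 393, (3.26) p. 395, (3.28) p. 395, (3.40)–(3.41) p. 397; [5] (8)–(9) p. 18, pp. 24–25,
(139)–(147) pp. 39–40; [B8] (1.58)–(1.59) p. 86, p. 77 («Ω_j = T_η»); [B4] (1.18) p. 20.

WHAT IS PROVED (kernel, 0 sorry; theorems only, no `def`, no `… : Prop` fact, no `instance`).
* §1 (signed taxicab dictionary, extending `B9B8KnitVsTaxicab.taxiRun_transl` to legs of either sign): `iterate_unshift_transl`, ★ `parBwdV_transl`,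
  ★ `taxiLegV_transl_neg`, ★★ `taxiRun_transl_signed`, ★★ `parTaxiV_transl` — `parTaxiV U (0 + c) (0 + y) = U♯(seg_0(y_0−c_0) ⋯ seg_d(y_d−c_d))` whenever
  `2|y_μ − c_μ| < N₀`.
* §2 (`ℤ^D`): `length_flatMap_seg`, `disp_flatMap_seg`; ★★ `norm_loop_sub_one_le` — for a unitary `U₀ ∈ Reg17 L n ℤ^D α` and two points `c, y` of the double box
  of a level-`n` bond with corner `x₀`: `‖U₀(Γ^{taxi}_{c→y})·(U₀(Γ^{taxi}_{c→x₀})·U₀(Γ^{tree}_{x₀→y}))⁻¹ − 1‖ ≤ 4(D+1)²α` (clamp + corner axial gauge + F1's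
  `norm_hol_sub_one_le`, locality `B7Prop1Local.hol_flatMap_seg_congr`).
* §3: ★★ `norm_qT_parBY_rebase_sub_one_le` — at a member of constant level, `U = bgY i U₀`: `‖qT_Y ι f·(U(Γ^{taxi}_{c→x₀})·qT_c ι f)⁻¹ − 1‖ ≤ 4(d+2)²α` whenever
  `qK ι f ≠ 0` (§1 + F3's `qT_cornerTree_eq`, `embIter_transl_zero` + §2).
* §4: `norm_QY_apply_le` (`‖(Q(U)a)(ι)‖ ≤ ‖a‖`), ★ `norm_QY_sub_QY_le`, ★★ `norm_sandwich_term_sub_le`, ★★ `norm_sandwich_sub_le` — the sandwich under an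
  `ε`-re-basing moves by `≤ 8ε·c_f²L^{−2n}·‖a‖` per fine bond.
* §5: ★★★ `hQQ_parBY_bgY` — `|Q*(U)aQ(U)a − (c_fη)²·(QQZdP(U₀)a♯)♭|₍₋₃₎ ≤ ε_Q·|a|₍₋₁₎` at `parB = parBY i`, `U = bgY i U₀`, every bond function `a`, for a unitary
  `N₀`-periodic `U₀ ∈ Reg17 L n ℤ^{d+1} α`, `0 < α ≤ α_Q∕L²` (the last conjunct of `B9B8KnitTorusSocketBetaZero.sockB9P3Per_torusIdx_of_sectors₀`'s `hY`).
* §6: ★★★ `hQQ_parBY_of_inAk` — the same from `InAk L n η α₀ ℤ^{d+1} U₀` at any `α₀ ≤ a_T ≤ α_Q∕L²`, with `ε_Q(a_T)` uniform in `α₀`, `U₀` (the binder shape of `hY`).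

HONEST SCOPE.  Per background and per member of constant level; the other conjuncts of the socket's `hY` (`Δ_a`, `G_a` bounds, `Δ′_a`, `X`, curvature) are NOT
here; count-neutral; `stub_PV3A` NOT discharged; nothing continuum ∕ ℝ⁴ ∕ OS ∕ mass gap ∕ Clay — the Yang–Mills mass gap is NOT proved here.  NEW file;
F1–F3, p33's `B9B8KnitVsTaxicab`, def-Y's `OpsYTransport` and the dictionaries are used BY NAME, nothing landed is modified.
-/

noncomputable section

namespace Literature.MathematicalPhysics.QuantumFieldTheory.Balaban1983to89.B9B8KnitAveragingClosenessAtCentre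

open scoped BigOperators
open Node00
open B7Prop1Explicit renaming Site → LSite
open B7Prop1Explicit hiding Site
open B7Prop1Local (InBox AgreeOn loK bondHiK clampCfg clampCfg_agree clampCfg_mem clamp_inBox pdev_clampCfg_le hol_flatMap_seg_congr hol_treeWord_congr)
open B7Prop2Explicit (unitaryUnits hol_mem_of pdev le_pdev unitaryUnits_le_U1)
open B7AvgGaugeCovariance (pdev_gaugeAct)
open B8Eq115GaugeFixing (gaugeAct_mem_of)
open B8Ineq132 (pdevOn_lt_of_forall)
open B6KLevelCensusIndexV1 (KIdx)
open B6GlobalChartV1 (PV)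
open B8ScaledSupNorm (weight)
open B10Eq27TorusAxialLog (transl transl_apply rel transl_rel transl_add_e transl_sub_e)
open B15DeterminingSets (embIter)
open B9B8CarrierDictionary (liftCfg liftCfg_apply liftCfg_mem conjR_eq_R)
open B9B8KnitBondTransfer (liftBd descBd liftBd_apply)
open B9B8KnitVsTaxicab (parFwdV_transl iterate_shift_transl taxiLegV_transl taxiRun_cons')
open B9B8KnitColumnGauge (l1_sub_le_of_inBox clamp_regular)
open B9B8KnitColumnFlatness (norm_hol_sub_one_le)
open B9B8KnitAveragingClosenessAtCorner (qT_cornerTree_eq qT_cornerTree_mem embIter_transl_zero hQQ_cornerTree_bgY QsY_aY_QY_rebase)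
open B9B8KnitAveragingClosenessOfColumns (QsY_apply abs_qK_le_one norm_R_le_of_mem_unitaryUnits)
open B9B8KnitFlatAveragingAgreement (aY_apply transl_winBase_injective)
open B9B8KnitBondAvgColumns (exists_ibondY_of_constLev)
open B9B8KnitBondAvgSupport (window_winBase ibondY_eq_of_key_eq dir_eq_of_qK_ne_zero src_eq_winBase_of_qK_ne_zero)
open B8Thm2TorusMemberWeighted (ibondY_level_eq)
open B9B8KnitNeumannCore (wNormBY_eq_weight_mul_norm)
open B9B8KnitNormsTransfer (weight_level_pos)
open B9Eq316AveragingTransposeZd (betaTau winBase wQ alphaQ alphaQ_pos Reg17 reg17_mono reg17_of_inAk inBox_winBase)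
open B8Ineq132 (InAk)
open B9Eq316AveragingTransposeZdPrinted (QQZdP)
open B8Thm2TorusMember (TorusMember torusIdx torusLamb)
open B8Thm2TorusLettersPerOfKnit (bgY liftCfg_bgY bgY_mem)
open B9B8KnitLandauProjection (shiftCfg_eq_of_isPeriodic)
open T4TermwiseTorus (IsPeriodic)
open B9Eq39Adjoint (R R_smul R_add R_sub R_inv_R)
open B9Eq3132Ineq2142Covariant (qK_apply sum_qwt_eq_one)
open B6Ineq2142KLevelV1 (qwt qwt_le qwt_nonneg)

variable {d ℓ : ℕ} {hd : 1 ≤ d + 1} {hL : Odd (ℓ + 1) ∧ 1 < ℓ + 1} {b₀ b₁ : ℝ}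

/-! ## §1 The signed taxicab dictionary: def-Y's `parTaxiV` read on `ℤ^{d+1}` for short displacements of either sign -/

section Taxi

variable {𝔸 : Type} [NormedRing 𝔸] [NormedAlgebra ℂ 𝔸] [CompleteSpace 𝔸] (i : KIdx d ℓ hd hL b₀ b₁)

omit [NormedAlgebra ℂ 𝔸] [CompleteSpace 𝔸] in
/-- `t` backward unit steps on the torus = translation by `−t·e_μ` on the lift. [cite: Balaban1985BackgroundPropagators, (3.3) p.391, bookkeeping] -/
theorem iterate_unshift_transl (μ : Fin (d + 1)) : ∀ (t : ℕ) (x : LSite (d + 1)),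
    (fun y : Site (PV d ℓ i.m i.K hd hL) 0 => y.unshift μ)^[t] (transl (0 : Site (PV d ℓ i.m i.K hd hL) 0) x) = transl 0 (x - (t : ℤ) • e μ)
  | 0, x => by simp
  | t + 1, x => by
      rw [Function.iterate_succ_apply', iterate_unshift_transl μ t x, ← transl_sub_e, Nat.cast_succ, add_smul, one_smul, sub_sub]

/-- ★ a BACKWARD LEG on the torus is the backward straight-segment holonomy of the periodic lift: `parBwdV U μ n (0 + x) = (liftCfg U)(x; seg_μ (−n))`.
[cite: Balaban1985BackgroundPropagators, (3.3), (3.8) pp.391–392, dictionary] -/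
theorem parBwdV_transl (U : CfgY 𝔸 i) (μ : Fin (d + 1)) :
    ∀ (n : ℕ) (x : LSite (d + 1)), parBwdV U μ n (transl (0 : Site (PV d ℓ i.m i.K hd hL) 0) x) = hol (liftCfg U) x (seg μ (-(n : ℤ)))
  | 0, x => by simp
  | n + 1, x => by
      rw [parBwdV_succ, ← transl_sub_e, parBwdV_transl U μ n (x - e μ), seg_neg_natCast, seg_neg_natCast, List.replicate_succ, hol_cons, stepHol_false,
        Letter.vec_false, liftCfg_apply, ← sub_eq_add_neg]

/-- ★ ONE BACKWARD TAXICAB LEG towards `0 + z` from `0 + w` with `z_μ = w_μ − t`, `0 < t`, `2t < N₀` (backward is the shorter way round): `t` backward bonds.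
[cite: Balaban1985BackgroundPropagators, (3.40) p.397 («a shortest contour»), (3.3), (3.8) pp.391–392] -/
theorem taxiLegV_transl_neg (U : CfgY 𝔸 i) {z w : LSite (d + 1)} {μ : Fin (d + 1)} {t : ℕ} (ht : z μ = w μ - t) (ht0 : 0 < t)
    (h2 : 2 * t < (PV d ℓ i.m i.K hd hL).sitesPerDir 0) (acc : 𝔸ˣ) :
    taxiLegV U (transl (0 : Site (PV d ℓ i.m i.K hd hL) 0) z) (transl 0 w, acc) μ =
      (transl 0 (w - (t : ℤ) • e μ), acc * hol (liftCfg U) w (seg μ (-(t : ℤ)))) := by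
  have htN : t < (PV d ℓ i.m i.K hd hL).sitesPerDir 0 := by omega
  have hdiff : transl (0 : Site (PV d ℓ i.m i.K hd hL) 0) w μ - transl (0 : Site (PV d ℓ i.m i.K hd hL) 0) z μ = (t : ZMod _) := by
    rw [transl_apply, transl_apply, ht]; push_cast; ring
  have hdiff' : transl (0 : Site (PV d ℓ i.m i.K hd hL) 0) z μ - transl (0 : Site (PV d ℓ i.m i.K hd hL) 0) w μ = -(t : ZMod _) := by
    rw [← neg_sub, hdiff]
  have h1 : (transl (0 : Site (PV d ℓ i.m i.K hd hL) 0) w μ - transl (0 : Site (PV d ℓ i.m i.K hd hL) 0) z μ).val = t := by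
    rw [hdiff, ZMod.val_natCast, Nat.mod_eq_of_lt htN]
  have hne : ((t : ℕ) : ZMod ((PV d ℓ i.m i.K hd hL).sitesPerDir 0)) ≠ 0 := fun h0 => by
    have := congrArg ZMod.val h0
    rw [ZMod.val_natCast, Nat.mod_eq_of_lt htN, ZMod.val_zero] at this
    omega
  have h2' : (transl (0 : Site (PV d ℓ i.m i.K hd hL) 0) z μ - transl (0 : Site (PV d ℓ i.m i.K hd hL) 0) w μ).val =
      (PV d ℓ i.m i.K hd hL).sitesPerDir 0 - t := by
    rw [hdiff', ZMod.neg_val, if_neg hne, ZMod.val_natCast, Nat.mod_eq_of_lt htN]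
  unfold taxiLegV
  rw [if_neg (by rw [h1, h2']; omega), h1, iterate_unshift_transl i μ t w, parBwdV_transl]

/-- ★★ THE WHOLE SIGNED RUN over distinct directions `l`, from `0 + w` towards `0 + z` with `2|z_μ − w_μ| < N₀` on `l` (each leg the shorter way round,
forward or backward): the transporter accumulates the holonomy of the lift along `l.flatMap (μ ↦ seg_μ (z_μ − w_μ))`.
[cite: Balaban1985BackgroundPropagators, (3.40) p.397, (3.3), (3.8) pp.391–392] -/
theorem taxiRun_transl_signed (U : CfgY 𝔸 i) (z : LSite (d + 1)) :
    ∀ (l : List (Fin (d + 1))), l.Nodup → ∀ (w : LSite (d + 1)) (acc : 𝔸ˣ),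
      (∀ μ ∈ l, 2 * |z μ - w μ| < (((PV d ℓ i.m i.K hd hL).sitesPerDir 0 : ℕ) : ℤ)) →
      (taxiRun U (transl (0 : Site (PV d ℓ i.m i.K hd hL) 0) z) l (transl 0 w, acc)).2 =
        acc * hol (liftCfg U) w (l.flatMap fun μ => seg μ (z μ - w μ))
  | [], _, w, acc, _ => by simp [taxiRun, hol_nil]
  | μ :: l, hl, w, acc, h => by
      have hμ := h μ (by simp)
      have hnd : μ ∉ l := (List.nodup_cons.1 hl).1
      -- one leg, of either sign
      have hleg : taxiLegV U (transl (0 : Site (PV d ℓ i.m i.K hd hL) 0) z) (transl 0 w, acc) μ =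
          (transl 0 (w + (z μ - w μ) • e μ), acc * hol (liftCfg U) w (seg μ (z μ - w μ))) := by
        obtain ⟨t, ht | ht⟩ := Int.eq_nat_or_neg (z μ - w μ)
        · have hzt : z μ = w μ + t := by linarith
          have h2 : 2 * t ≤ (PV d ℓ i.m i.K hd hL).sitesPerDir 0 := by
            have := hμ; rw [ht] at this; rw [abs_of_nonneg (by positivity)] at this; exact_mod_cast this.le
          rw [taxiLegV_transl i U hzt h2 acc, ht]
        · rcases Nat.eq_zero_or_pos t with h0 | hpos
          · subst h0
            have hzt : z μ = w μ + (0 : ℕ) := by simp at ht; push_cast; linarith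
            rw [taxiLegV_transl i U hzt (by positivity) acc, ht]
            simp
          · have hzt : z μ = w μ - t := by linarith
            have h2 : 2 * t < (PV d ℓ i.m i.K hd hL).sitesPerDir 0 := by
              have := hμ; rw [ht, abs_neg] at this; rw [abs_of_nonneg (by positivity)] at this; exact_mod_cast this
            rw [taxiLegV_transl_neg i U hzt hpos h2 acc, ht, neg_smul, sub_eq_add_neg]
      rw [taxiRun_cons', hleg,
        taxiRun_transl_signed U z l (List.nodup_cons.1 hl).2 (w + (z μ - w μ) • e μ) _ (fun ν hν => ?_)]
      · have hrest : (l.flatMap fun ν => seg ν (z ν - (w + (z μ - w μ) • e μ) ν)) = l.flatMap fun ν => seg ν (z ν - w ν) := by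
          refine List.flatMap_congr fun ν hν => ?_
          have hne : ν ≠ μ := fun h' => hnd (h' ▸ hν)
          simp [e_apply, hne]
        rw [hrest, List.flatMap_cons, hol_append, disp_seg, mul_assoc]
      · have hne : ν ≠ μ := fun h' => hnd (h' ▸ hν)
        have : (w + (z μ - w μ) • e μ) ν = w ν := by simp [e_apply, hne]
        rw [this]; exact h ν (by simp [hν])

/-- ★★ **def-Y's TAXICAB TRANSPORTER READ ON `ℤ^{d+1}`, SIGNED**: for integer points `c, y` with `2|y_μ − c_μ| < N₀` in every coordinate,
`parTaxiV U (0 + c) (0 + y) = U♯(Γ^{taxi}_{c→y})`, the taxicab word being `seg_0(y_0 − c_0) ⋯ seg_d(y_d − c_d)` (legs of either sign).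
[cite: Balaban1985BackgroundPropagators, (3.40) p.397 («Γ_{x,x′} a shortest contour»), (3.12) p.392, (3.3) p.391] -/
theorem parTaxiV_transl (U : CfgY 𝔸 i) (c y : LSite (d + 1)) (h : ∀ μ, 2 * |y μ - c μ| < (((PV d ℓ i.m i.K hd hL).sitesPerDir 0 : ℕ) : ℤ)) :
    parTaxiV U (transl (0 : Site (PV d ℓ i.m i.K hd hL) 0) c) (transl (0 : Site (PV d ℓ i.m i.K hd hL) 0) y) =
      hol (liftCfg U) c ((List.finRange (d + 1)).flatMap fun μ => seg μ (y μ - c μ)) := by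
  have h := taxiRun_transl_signed i U y (List.finRange (d + 1)) (List.nodup_finRange _) c 1 (fun μ _ => h μ)
  rw [one_mul] at h
  exact h

end Taxi

/-! ## §2 `ℤ^D`: the centre–corner–bond loop is `O(α)` in the regime (1.7) -/

section Loop

variable {D : ℕ} {𝔸 : Type} [CStarAlgebra 𝔸] [Nontrivial 𝔸] (L : ℕ)

omit [Nontrivial 𝔸] in
/-- `‖XY − 1‖ ≤ ‖X − 1‖ + ‖Y − 1‖` for `‖Y‖ ≤ 1`. [folklore] -/
private theorem norm_mul_sub_one_le_add {X Y : 𝔸} (hY : ‖Y‖ ≤ 1) : ‖X * Y - 1‖ ≤ ‖X - 1‖ + ‖Y - 1‖ := by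
  rw [show X * Y - 1 = (X - 1) * Y + (Y - 1) by noncomm_ring]
  exact (norm_add_le _ _).trans (add_le_add ((norm_mul_le _ _).trans (mul_le_of_le_one_right (norm_nonneg _) hY)) le_rfl)

omit [CStarAlgebra 𝔸] [Nontrivial 𝔸] in
/-- the signed taxicab word has `|v|₁` letters. [cite: Balaban1985BackgroundPropagators, (3.40) p.397, bookkeeping] -/
theorem length_flatMap_seg (v : LSite D) : ((List.finRange D).flatMap fun μ => seg μ (v μ)).length = l1 v := by
  rw [List.length_flatMap, l1, Fin.sum_univ_def]
  simp

omit [CStarAlgebra 𝔸] [Nontrivial 𝔸] in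
/-- the signed taxicab word ends at `v`. [cite: Balaban1985BackgroundPropagators, (3.40) p.397, bookkeeping] -/
theorem disp_flatMap_seg (v : LSite D) : disp ((List.finRange D).flatMap fun μ => seg μ (v μ)) = v := by
  rw [disp_flatMap]
  simp only [disp_seg]
  conv_rhs => rw [← sum_zsmul_e v]
  rw [Fin.sum_univ_def]

omit [CStarAlgebra 𝔸] [Nontrivial 𝔸] in
/-- the corner lies below the top of the double box. [folklore] -/
private theorem loK_le_bondHiK (hL : 1 ≤ L) (j : ℕ) (z : LSite D) (κ : Fin D) (i : Fin D) : loK L j z i ≤ bondHiK L j z κ i := by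
  have h1 : (1 : ℤ) ≤ (L : ℤ) ^ j := by exact_mod_cast Nat.one_le_pow j L hL
  simp only [loK, bondHiK]
  split_ifs <;> linarith

omit [CStarAlgebra 𝔸] [Nontrivial 𝔸] in
/-- the corner lies in the double box. [folklore] -/
private theorem loK_inBox (hL : 1 ≤ L) (j : ℕ) (z : LSite D) (κ : Fin D) : InBox (loK L j z) (bondHiK L j z κ) (loK L j z) :=
  fun i => ⟨le_rfl, loK_le_bondHiK L hL j z κ i⟩

omit [Nontrivial 𝔸] in
/-- `V(Γ) = u(Γ₋)⁻¹·V^u(Γ)·u(Γ₊)` ((8) rearranged). [cite: Balaban1985Averaging, (8) p.18] -/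
private theorem hol_eq_conj_gaugeAct (u : LSite D → 𝔸ˣ) (V : LSite D → Fin D → 𝔸ˣ) (x : LSite D) (w : List (Letter D)) :
    hol V x w = (u x)⁻¹ * hol (gaugeAct u V) x w * u (x + disp w) := by
  rw [hol_gaugeAct]; group

/-- ★★ **THE CENTRE–BOND–CORNER LOOP IS `O(α)`**: for a unitary `U₀ ∈ Reg17 L n ℤ^D α` (`α > 0`), a level-`n` bond `(w, κ)` with box corner `x₀ = Lⁿw`, and two
points `c, y` of the double box `Bⁿ(c₋) ∪ Bⁿ(c₊)`:
`‖U₀(Γ^{taxi}_{c→y})·(U₀(Γ^{taxi}_{c→x₀})·U₀(Γ^{tree}_{x₀→y}))⁻¹ − 1‖ ≤ 4(D+1)²·α` — the holonomy of the closed contour `c → y → x₀ → c` (length `≤ 4(D+1)Lⁿ`)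
in the corner axial gauge, where every bond variable of the double box is within `(D+1)·α·L^{−n}` of `1` ([5] pp. 24–25).
[cite: Balaban1985Averaging, pp.24–25 («|V₀,b − 1| < |b₋ − y|α₀»), (8)–(9) p.18; Balaban1985BackgroundPropagators, (3.12) p.392, (3.40) p.397] -/
theorem norm_loop_sub_one_le (hL : 1 ≤ L) {n : ℕ} {α : ℝ} (hα : 0 < α) {U₀ : LSite D → Fin D → 𝔸ˣ} (hU₀ : ∀ x κ, U₀ x κ ∈ unitaryUnits 𝔸)
    (hreg : Reg17 L n (fun _ => (Set.univ : Set (LSite D))) α U₀) (w : LSite D) (κ : Fin D) {c y : LSite D}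
    (hc : InBox (loK L n w) (bondHiK L n w κ) c) (hy : InBox (loK L n w) (bondHiK L n w κ) y) :
    ‖((hol U₀ c ((List.finRange D).flatMap fun μ => seg μ ((y - c) μ)) *
        (hol U₀ c ((List.finRange D).flatMap fun μ => seg μ ((loK L n w - c) μ)) * hol U₀ (loK L n w) (treeWord (y - loK L n w)))⁻¹ : 𝔸ˣ) : 𝔸) - 1‖ ≤
      4 * ((D : ℝ) + 1) ^ 2 * α := by
  have hL0 : (0 : ℝ) < L := by exact_mod_cast hL
  set lo := loK L n w with hlo
  set hi := bondHiK L n w κ with hhi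
  have hlohi : ∀ j, lo j ≤ hi j := loK_le_bondHiK L hL n w κ
  have hlo_in : InBox lo hi lo := loK_inBox L hL n w κ
  -- (i) clamp: `U₁` agrees with `U₀` on the box, is unitary, and has small plaquette deviation everywhere
  obtain ⟨hU₁, hpd₁, hag₁⟩ := clamp_regular L hL hα hU₀ hreg w κ
  set U₁ := clampCfg lo hi U₀ with hU₁def
  have hU₁U1 : ∀ x ν, U₁ x ν ∈ U1 𝔸 := fun x ν => unitaryUnits_le_U1 (hU₁ x ν)
  -- (ii) the corner axial gauge
  set u : LSite D → 𝔸ˣ := axialFn U₁ lo with hu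
  have hu_mem : ∀ x, u x ∈ unitaryUnits 𝔸 := fun x => hol_mem_of hU₁ _ _
  have hu_U1 : ∀ x, u x ∈ U1 𝔸 := fun x => unitaryUnits_le_U1 (hu_mem x)
  set V₁ := gaugeAct u U₁ with hV₁
  have hV₁mem : ∀ x ν, V₁ x ν ∈ unitaryUnits 𝔸 := gaugeAct_mem_of hU₁ hu_mem
  have hV₁U1 : ∀ x ν, V₁ x ν ∈ U1 𝔸 := fun x ν => unitaryUnits_le_U1 (hV₁mem x ν)
  have hclose₁ : ∀ x ν, InBox lo hi x → ‖((V₁ x ν : 𝔸ˣ) : 𝔸) - 1‖ ≤ ((D : ℝ) + 1) * α * ((L : ℝ) ^ n)⁻¹ := by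
    intro x ν hx
    have h44 : ∀ (x : LSite D) (κ μ : Fin D), κ ≠ μ → ‖((hol U₁ x (plaqWord κ μ) : 𝔸ˣ) : 𝔸) - 1‖ ≤ α * (((L : ℝ) ^ n)⁻¹) ^ 2 :=
      fun x κ μ _ => (le_pdev hU₁U1 x κ μ).trans hpd₁.le
    have h := axial_bond_bound U₁ hU₁U1 lo h44 (by positivity) x ν
    refine h.trans ?_
    have hl1 := l1_sub_le_of_inBox L hx
    have hLn : (0 : ℝ) < (L : ℝ) ^ n := by positivity
    calc (l1 (x - lo) : ℝ) * (α * (((L : ℝ) ^ n)⁻¹) ^ 2) ≤ ((D : ℝ) + 1) * (L : ℝ) ^ n * (α * (((L : ℝ) ^ n)⁻¹) ^ 2) :=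
          mul_le_mul_of_nonneg_right hl1 (by positivity)
      _ = ((D : ℝ) + 1) * α * ((L : ℝ) ^ n)⁻¹ := by field_simp
  -- (iii) clamp the gauged field: globally within `(D+1)αL^{−n}` of `1`
  set V := clampCfg lo hi V₁ with hVdef
  have hVmem : ∀ x ν, V x ν ∈ unitaryUnits 𝔸 := clampCfg_mem hV₁mem
  have hVU1 : ∀ x ν, V x ν ∈ U1 𝔸 := fun x ν => unitaryUnits_le_U1 (hVmem x ν)
  have hagV : AgreeOn lo hi V V₁ := clampCfg_agree V₁
  have hρ : ∀ x ν, ‖((V x ν : 𝔸ˣ) : 𝔸) - 1‖ ≤ ((D : ℝ) + 1) * α * ((L : ℝ) ^ n)⁻¹ := by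
    intro x ν
    show ‖((clampCfg lo hi V₁ x ν : 𝔸ˣ) : 𝔸) - 1‖ ≤ _
    unfold clampCfg
    split_ifs with hcx
    · exact hclose₁ _ ν (clamp_inBox hlohi x)
    · rw [Units.val_one, sub_self, norm_zero]; positivity
  -- (iv) the three legs read in the gauge: `U₀(Γ) = u(Γ₋)⁻¹·V(Γ)·u(Γ₊)` for contours inside the box
  have hend_a : ∀ μ ∈ List.finRange D, lo μ ≤ c μ + (y - c) μ ∧ c μ + (y - c) μ ≤ hi μ := fun μ _ => by
    rw [Pi.sub_apply, add_sub_cancel]; exact hy μ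
  have hend_c : ∀ μ ∈ List.finRange D, lo μ ≤ c μ + (lo - c) μ ∧ c μ + (lo - c) μ ≤ hi μ := fun μ _ => by
    rw [Pi.sub_apply, add_sub_cancel]; exact hlo_in μ
  have hleg : ∀ (x : LSite D) (wd : List (Letter D)), hol U₀ x wd = hol U₁ x wd → hol V₁ x wd = hol V x wd →
      hol U₀ x wd = (u x)⁻¹ * hol V x wd * u (x + disp wd) := by
    intro x wd h01 h1V
    rw [h01, hol_eq_conj_gaugeAct u U₁ x wd, ← hV₁, h1V]
  have ha := hleg c ((List.finRange D).flatMap fun μ => seg μ ((y - c) μ))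
    (hol_flatMap_seg_congr hag₁.symm (y - c) _ (List.nodup_finRange D) c hc hend_a)
    (hol_flatMap_seg_congr hagV.symm (y - c) _ (List.nodup_finRange D) c hc hend_a)
  have hcleg := hleg c ((List.finRange D).flatMap fun μ => seg μ ((lo - c) μ))
    (hol_flatMap_seg_congr hag₁.symm (lo - c) _ (List.nodup_finRange D) c hc hend_c)
    (hol_flatMap_seg_congr hagV.symm (lo - c) _ (List.nodup_finRange D) c hc hend_c)
  have hb := hleg lo (treeWord (y - lo))
    (hol_treeWord_congr hag₁.symm lo (y - lo) hlo_in (by rw [add_sub_cancel]; exact hy))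
    (hol_treeWord_congr hagV.symm lo (y - lo) hlo_in (by rw [add_sub_cancel]; exact hy))
  -- the three gauged holonomies are each within `length·σ` of `1`
  set σ : ℝ := ((D : ℝ) + 1) * α * ((L : ℝ) ^ n)⁻¹ with hσ
  set Ka : 𝔸ˣ := hol V c ((List.finRange D).flatMap fun μ => seg μ ((y - c) μ)) with hKa
  set Kc : 𝔸ˣ := hol V c ((List.finRange D).flatMap fun μ => seg μ ((lo - c) μ)) with hKc
  set Kb : 𝔸ˣ := hol V lo (treeWord (y - lo)) with hKb
  have hKa1 : ‖(Ka : 𝔸) - 1‖ ≤ (l1 (y - c) : ℝ) * σ := by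
    have h := norm_hol_sub_one_le hVU1 hρ c ((List.finRange D).flatMap fun μ => seg μ ((y - c) μ))
    rwa [length_flatMap_seg] at h
  have hKc1 : ‖(Kc : 𝔸) - 1‖ ≤ (l1 (lo - c) : ℝ) * σ := by
    have h := norm_hol_sub_one_le hVU1 hρ c ((List.finRange D).flatMap fun μ => seg μ ((lo - c) μ))
    rwa [length_flatMap_seg] at h
  have hKb1 : ‖(Kb : 𝔸) - 1‖ ≤ (l1 (y - lo) : ℝ) * σ := by
    have h := norm_hol_sub_one_le hVU1 hρ lo (treeWord (y - lo))
    rwa [length_treeWord] at h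
  have hKaU : Ka ∈ U1 𝔸 := hol_mem hVU1 _ _
  have hKbU : Kb ∈ U1 𝔸 := hol_mem hVU1 _ _
  have hKcU : Kc ∈ U1 𝔸 := hol_mem hVU1 _ _
  -- lengths
  have hla : (l1 (y - c) : ℝ) ≤ 2 * (((D : ℝ) + 1) * (L : ℝ) ^ n) := by
    have h1 : l1 (y - c) ≤ l1 (y - lo) + l1 (lo - c) := by
      have := l1_add_le (y - lo) (lo - c); rwa [sub_add_sub_cancel] at this
    have h2 := l1_sub_le_of_inBox L hy
    have h3 : (l1 (lo - c) : ℝ) ≤ ((D : ℝ) + 1) * (L : ℝ) ^ n := by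
      rw [← l1_neg, neg_sub]; exact l1_sub_le_of_inBox L hc
    have h1' : (l1 (y - c) : ℝ) ≤ (l1 (y - lo) : ℝ) + (l1 (lo - c) : ℝ) := by exact_mod_cast h1
    linarith
  have hlb : (l1 (y - lo) : ℝ) ≤ ((D : ℝ) + 1) * (L : ℝ) ^ n := l1_sub_le_of_inBox L hy
  have hlc : (l1 (lo - c) : ℝ) ≤ ((D : ℝ) + 1) * (L : ℝ) ^ n := by
    rw [← l1_neg, neg_sub]; exact l1_sub_le_of_inBox L hc
  have hσ0 : 0 ≤ σ := by positivity
  -- the loop in the gauge: `u(c)⁻¹·(K_a·K_b⁻¹·K_c⁻¹)·u(c)`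
  have hW : hol U₀ c ((List.finRange D).flatMap fun μ => seg μ ((y - c) μ)) *
      (hol U₀ c ((List.finRange D).flatMap fun μ => seg μ ((lo - c) μ)) * hol U₀ lo (treeWord (y - lo)))⁻¹ =
      (u c)⁻¹ * (Ka * Kb⁻¹ * Kc⁻¹) * u c := by
    rw [ha, hcleg, hb, disp_flatMap_seg, disp_flatMap_seg, disp_treeWord, add_sub_cancel, add_sub_cancel, add_sub_cancel]
    group
  rw [hW]
  calc ‖((((u c)⁻¹ * (Ka * Kb⁻¹ * Kc⁻¹) * u c : 𝔸ˣ)) : 𝔸) - 1‖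
      ≤ ‖((Ka * Kb⁻¹ * Kc⁻¹ : 𝔸ˣ) : 𝔸) - 1‖ := by
        rw [Units.val_mul, Units.val_mul]
        exact norm_units_inv_conj_sub_one_le (hu_U1 c) _
    _ ≤ ‖(Ka : 𝔸) - 1‖ + ‖((Kb⁻¹ : 𝔸ˣ) : 𝔸) - 1‖ + ‖((Kc⁻¹ : 𝔸ˣ) : 𝔸) - 1‖ := by
        rw [Units.val_mul, Units.val_mul]
        exact (norm_mul_sub_one_le_add (mem_U1.1 hKcU).2).trans (add_le_add (norm_mul_sub_one_le_add (mem_U1.1 hKbU).2) le_rfl)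
    _ ≤ ‖(Ka : 𝔸) - 1‖ + ‖(Kb : 𝔸) - 1‖ + ‖(Kc : 𝔸) - 1‖ := by
        gcongr
        exacts [norm_inv_sub_one_le hKbU, norm_inv_sub_one_le hKcU]
    _ ≤ (l1 (y - c) : ℝ) * σ + (l1 (y - lo) : ℝ) * σ + (l1 (lo - c) : ℝ) * σ := add_le_add (add_le_add hKa1 hKb1) hKc1
    _ ≤ 2 * (((D : ℝ) + 1) * (L : ℝ) ^ n) * σ + ((D : ℝ) + 1) * (L : ℝ) ^ n * σ + ((D : ℝ) + 1) * (L : ℝ) ^ n * σ := by gcongr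
    _ = 4 * ((D : ℝ) + 1) ^ 2 * α := by
        have hLn : (L : ℝ) ^ n ≠ 0 := by positivity
        rw [hσ]; field_simp; ring

end Loop

/-! ## §3 The member's torus: print's centre-taxicab transporter, re-based at the block corner, is the corner-tree transporter up to an `O(α)` loop -/

section Rebase

variable {𝔸 : Type} [CStarAlgebra 𝔸] [Nontrivial 𝔸] (i : KIdx d ℓ hd hL b₀ b₁) {n : ℕ}

/-- ★★ **`qT_Y ι f = W_ι(f)·U(Γ^{taxi}_{c→x₀})·qT_c ι f` WITH `‖W_ι(f) − 1‖ ≤ 4(d+2)²α`.**  At a member of constant level `n`, for a unitary `N₀`-periodic background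
`U₀ ∈ Reg17 L n ℤ^{d+1} α`, `U = bgY i U₀`, an index bond `ι` (block centre `c = embIter n ι₋`, corner `x₀ = c − (Lⁿ−1)∕2·𝟙`) and a fine bond `f` seen by `ι`
(`qK ι f ≠ 0`): print's transporter `qT parBY U ι f = U(Γ^{taxi}_{c→f₋})` ([4] (3.12), (3.40)), divided by `U(Γ^{taxi}_{c→x₀})·U♯(Γ^{tree}_{x₀→f₋})` (the corner-tree
transporter re-based to the centre), is the holonomy of the closed contour `c → f₋ → x₀ → c` inside `Bⁿ(ι₋) ∪ Bⁿ(ι₊)`, within `4(d+2)²α` of `1` (§2).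
[cite: Balaban1985BackgroundPropagators, (3.12) p.392, (3.40) p.397; Balaban1985Averaging, pp.24–25, (141) p.39] -/
theorem norm_qT_parBY_rebase_sub_one_le (hD : ∀ x, i.D.lev x = n) (hk : i.k = n + 1)
    {α : ℝ} (hα : 0 < α) {U₀ : LSite (d + 1) → Fin (d + 1) → 𝔸ˣ} (hU₀ : ∀ x κ, U₀ x κ ∈ unitaryUnits 𝔸)
    (hper : IsPeriodic ((PV d ℓ i.m i.K hd hL).sitesPerDir 0) U₀)
    (hreg : Reg17 (ℓ + 1) n (fun _ => (Set.univ : Set (LSite (d + 1)))) α U₀)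
    (ι : IBondY i) (f : FBondY i) (hq : qK i ι f ≠ 0) :
    ‖((qT i (parBY i) (bgY i U₀) ι f *
        (parTaxiV (bgY i U₀) (embIter (ι.1.1 : ℕ) ι.1.2.src)
            (fun ν => embIter (ι.1.1 : ℕ) ι.1.2.src ν - ((((ℓ + 1) ^ n - 1) / 2 : ℕ) : ZMod ((PV d ℓ i.m i.K hd hL).sitesPerDir 0))) *
          qT i (fun (V : CfgY 𝔸 i) (s s' : Site (PV d ℓ i.m i.K hd hL) 0) =>
        hol (liftCfg V)
          (rel (0 : Site (PV d ℓ i.m i.K hd hL) 0) s' -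
            fun ν => ((((s' ν - s ν + ((((ℓ + 1) ^ n - 1) / 2 : ℕ) : ZMod ((PV d ℓ i.m i.K hd hL).sitesPerDir 0))).val : ℕ) : ℤ)))
          (treeWord fun ν => ((((s' ν - s ν + ((((ℓ + 1) ^ n - 1) / 2 : ℕ) : ZMod ((PV d ℓ i.m i.K hd hL).sitesPerDir 0))).val : ℕ) : ℤ))))
            (bgY i U₀) ι f)⁻¹ : 𝔸ˣ) : 𝔸) - 1‖ ≤ 4 * ((d : ℝ) + 2) ^ 2 * α := by
  have hn : ((ι.1.1 : ℕ)) = n := ibondY_level_eq i hD hk ι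
  have hL1 : 1 ≤ ℓ + 1 := by omega
  have hL2 : 2 ≤ ℓ + 1 := hL.2
  have hnK : n + 1 ≤ i.m + i.K := by have := i.hk; rw [hk] at this; exact this
  have hlift : liftCfg (bgY i U₀) = U₀ := liftCfg_bgY i fun μ => shiftCfg_eq_of_isPeriodic hper μ
  obtain ⟨s₀, μ⟩ := f
  obtain ⟨t, ht⟩ := src_eq_winBase_of_qK_ne_zero i hq
  simp only at ht ⊢
  set y : LSite (d + 1) := rel (0 : Site (PV d ℓ i.m i.K hd hL) 0) s₀ with hy
  have ht' : ι.1.2.src = transl (0 : Site (PV d ℓ i.m i.K hd hL) (ι.1.1 : ℕ)) (winBase (ℓ + 1) n y μ t) := by rw [← hn]; exact ht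
  have hwin := window_winBase (d := d) hL1 n y μ t
  have hcentre₀ := embIter_transl_zero i (hn ▸ (by omega : n ≤ i.m + i.K)) (winBase (ℓ + 1) n y μ t)
  rw [← ht'] at hcentre₀
  have hNn : (ℓ + 1) ^ (ι.1.1 : ℕ) = (ℓ + 1) ^ n := by rw [hn]
  rw [hNn] at hcentre₀
  set N : ℕ := (ℓ + 1) ^ n with hN_def
  set cN : ℕ := (N - 1) / 2 with hcN_def
  set w := winBase (ℓ + 1) n y μ t with hw
  set P : ℤ := ((ℓ + 1 : ℕ) : ℤ) ^ n with hP_def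
  have hNN : ((N : ℕ) : ℤ) = P := by rw [hN_def, hP_def, Nat.cast_pow]
  set cv : LSite (d + 1) := fun ν => P * w ν + ((cN : ℕ) : ℤ) with hcv
  -- sizes
  have hN1 : 1 ≤ N := Nat.one_le_pow _ _ (by omega)
  have hcN : 2 * ((cN : ℕ) : ℤ) ≤ P - 1 := by
    have : 2 * cN ≤ N - 1 := Nat.mul_div_le _ _
    rw [← hNN]; omega
  have hcN0 : (0 : ℤ) ≤ ((cN : ℕ) : ℤ) := by positivity
  have hP0 : (0 : ℤ) ≤ P := by positivity
  have h4N : 4 * P ≤ ((((PV d ℓ i.m i.K hd hL).sitesPerDir 0 : ℕ) : ℤ)) := by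
    have h1 : (ℓ + 1) * N ≤ (ℓ + 1) ^ (i.m + i.K) := by
      rw [hN_def, ← pow_succ']; exact Nat.pow_le_pow_right hL1 hnK
    have h2 : 2 * N ≤ (ℓ + 1) ^ (i.m + i.K) := le_trans (Nat.mul_le_mul_right _ hL2) h1
    have h3 : 4 * N ≤ (PV d ℓ i.m i.K hd hL).sitesPerDir 0 := by
      show 4 * N ≤ 2 * (ℓ + 1) ^ (i.m + i.K - 0); rw [Nat.sub_zero]; omega
    rw [← hNN]; exact_mod_cast h3
  rw [hNN] at hwin
  have hsmall_a : ∀ ν, 2 * |y ν - cv ν| < ((((PV d ℓ i.m i.K hd hL).sitesPerDir 0 : ℕ) : ℤ)) := fun ν => by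
    obtain ⟨h1, h2⟩ := hwin ν
    have : |y ν - cv ν| < 2 * P := by
      rw [abs_lt]; simp only [hcv]; constructor <;> linarith
    linarith
  have hsmall_c : ∀ ν, 2 * |loK (ℓ + 1) n w ν - cv ν| < ((((PV d ℓ i.m i.K hd hL).sitesPerDir 0 : ℕ) : ℤ)) := fun ν => by
    have : |loK (ℓ + 1) n w ν - cv ν| < P := by
      rw [abs_lt]; simp only [hcv, loK]; constructor <;> linarith
    linarith
  -- the block centre and the corner
  have hcentre : embIter (ι.1.1 : ℕ) ι.1.2.src = transl (0 : Site (PV d ℓ i.m i.K hd hL) 0) cv := by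
    rw [hcentre₀, hcv]; simp only [hNN]
  have hcorner : (fun ν => transl (0 : Site (PV d ℓ i.m i.K hd hL) 0) cv ν - ((cN : ℕ) : ZMod ((PV d ℓ i.m i.K hd hL).sitesPerDir 0))) =
      transl (0 : Site (PV d ℓ i.m i.K hd hL) 0) (loK (ℓ + 1) n w) := by
    funext ν
    rw [transl_apply, transl_apply, show (0 : Site (PV d ℓ i.m i.K hd hL) 0) ν = 0 from rfl]
    simp only [hcv, loK, hP_def]
    push_cast
    ring
  -- the three readings on `ℤ^{d+1}`
  have hs₀ : transl (0 : Site (PV d ℓ i.m i.K hd hL) 0) y = s₀ := transl_rel _ s₀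
  have eY : qT i (parBY i) (bgY i U₀) ι ⟨s₀, μ⟩ = hol U₀ cv ((List.finRange (d + 1)).flatMap fun ν => seg ν (y ν - cv ν)) := by
    show parTaxiV (bgY i U₀) (embIter (ι.1.1 : ℕ) ι.1.2.src) s₀ = _
    rw [hcentre, ← hs₀, parTaxiV_transl i _ cv y hsmall_a, hlift]
  have eT : parTaxiV (bgY i U₀) (embIter (ι.1.1 : ℕ) ι.1.2.src)
      (fun ν => embIter (ι.1.1 : ℕ) ι.1.2.src ν - ((cN : ℕ) : ZMod ((PV d ℓ i.m i.K hd hL).sitesPerDir 0))) =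
      hol U₀ cv ((List.finRange (d + 1)).flatMap fun ν => seg ν (loK (ℓ + 1) n w ν - cv ν)) := by
    rw [hcentre, hcorner, parTaxiV_transl i _ cv _ hsmall_c, hlift]
  have eC : qT i (fun (V : CfgY 𝔸 i) (s s' : Site (PV d ℓ i.m i.K hd hL) 0) =>
        hol (liftCfg V)
          (rel (0 : Site (PV d ℓ i.m i.K hd hL) 0) s' -
            fun ν => ((((s' ν - s ν + ((cN : ℕ) : ZMod ((PV d ℓ i.m i.K hd hL).sitesPerDir 0))).val : ℕ) : ℤ)))
          (treeWord fun ν => ((((s' ν - s ν + ((cN : ℕ) : ZMod ((PV d ℓ i.m i.K hd hL).sitesPerDir 0))).val : ℕ) : ℤ))))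
      (bgY i U₀) ι ⟨s₀, μ⟩ = hol U₀ (loK (ℓ + 1) n w) (treeWord (y - loK (ℓ + 1) n w)) := by
    have h := qT_cornerTree_eq i (bgY i U₀) ι hn y μ μ t ht'
    rw [hs₀, hlift] at h
    exact h
  -- both points lie in the double box of `(w, μ)`
  have hy_in : InBox (loK (ℓ + 1) n w) (bondHiK (ℓ + 1) n w μ) y := inBox_winBase hL1 _ y μ t
  have hc_in : InBox (loK (ℓ + 1) n w) (bondHiK (ℓ + 1) n w μ) cv := fun ν => by
    simp only [hcv, loK, bondHiK]
    constructor
    · linarith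
    · split_ifs <;> linarith
  rw [eY, eT, eC]
  have h := norm_loop_sub_one_le (ℓ + 1) hL1 hα hU₀ hreg w μ hc_in hy_in
  refine h.trans (le_of_eq ?_)
  push_cast
  ring

end Rebase

/-! ## §4 def-Y's sandwich `Q*(U)aQ(U)` under an `ε`-re-basing of the block transporters -/

section Perturb

variable {𝔸 : Type} [CStarAlgebra 𝔸] [Nontrivial 𝔸] (i : KIdx d ℓ hd hL b₀ b₁) {n : ℕ}

/-- `‖R(V)X − X‖ ≤ 2‖V − 1‖·‖X‖` for `V` with `‖V‖, ‖V⁻¹‖ ≤ 1`. [cite: Balaban1985BackgroundPropagators, (3.28) p.395, bookkeeping] -/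
private theorem norm_R_sub_self_le {V : 𝔸ˣ} (hV : V ∈ U1 𝔸) (X : 𝔸) : ‖R V X - X‖ ≤ 2 * ‖(V : 𝔸) - 1‖ * ‖X‖ := by
  have h : R V X - X = ((V : 𝔸) - 1) * X * ((V⁻¹ : 𝔸ˣ) : 𝔸) + X * (((V⁻¹ : 𝔸ˣ) : 𝔸) - 1) := by
    rw [B9Eq39Adjoint.R_def]; noncomm_ring
  rw [h]
  have h1 : ‖((V : 𝔸) - 1) * X * ((V⁻¹ : 𝔸ˣ) : 𝔸)‖ ≤ ‖(V : 𝔸) - 1‖ * ‖X‖ := by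
    calc _ ≤ ‖((V : 𝔸) - 1) * X‖ * ‖((V⁻¹ : 𝔸ˣ) : 𝔸)‖ := norm_mul_le _ _
      _ ≤ ‖(V : 𝔸) - 1‖ * ‖X‖ * 1 := mul_le_mul (norm_mul_le _ _) (mem_U1.1 hV).2 (norm_nonneg _) (by positivity)
      _ = _ := mul_one _
  have h2 : ‖X * (((V⁻¹ : 𝔸ˣ) : 𝔸) - 1)‖ ≤ ‖X‖ * ‖(V : 𝔸) - 1‖ :=
    (norm_mul_le _ _).trans (mul_le_mul_of_nonneg_left (norm_inv_sub_one_le hV) (norm_nonneg _))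
  calc _ ≤ ‖((V : 𝔸) - 1) * X * ((V⁻¹ : 𝔸ˣ) : 𝔸)‖ + ‖X * (((V⁻¹ : 𝔸ˣ) : 𝔸) - 1)‖ := norm_add_le _ _
    _ ≤ ‖(V : 𝔸) - 1‖ * ‖X‖ + ‖X‖ * ‖(V : 𝔸) - 1‖ := add_le_add h1 h2
    _ = 2 * ‖(V : 𝔸) - 1‖ * ‖X‖ := by ring

/-- `‖(Q(U)a)(ι)‖ ≤ ‖a‖` for unitary transporters (the weights of `ι` have total mass one). [cite: Balaban1985BackgroundPropagators, (3.12) p.392; Balaban1984PropagatorsI, (1.18) p.20] -/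
theorem norm_QY_apply_le (parB : BondParY 𝔸 i) (U : CfgY 𝔸 i) (hunit : ∀ (ι : IBondY i) (f : FBondY i), qT i parB U ι f ∈ unitaryUnits 𝔸)
    (a : FBondY i → 𝔸) (ι : IBondY i) : ‖QY i parB U a ι‖ ≤ ‖a‖ := by
  classical
  rw [QY, trLiftY_apply]
  calc ‖∑ f', ((qK i ι f' : ℝ) : ℂ) • R (qT i parB U ι f') (a f')‖ ≤ ∑ f', ‖((qK i ι f' : ℝ) : ℂ) • R (qT i parB U ι f') (a f')‖ := norm_sum_le _ _
    _ ≤ ∑ f', qwt i.hN i.D i.hk ι f' * ‖a‖ := Finset.sum_le_sum fun f' _ => by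
        rw [norm_smul, Complex.norm_real, Real.norm_eq_abs, qK_apply, abs_of_nonneg (qwt_nonneg i.hN i.D i.hk ι f')]
        exact mul_le_mul_of_nonneg_left ((norm_R_le_of_mem_unitaryUnits (hunit ι f') _).trans (norm_le_pi_norm a f'))
          (qwt_nonneg i.hN i.D i.hk ι f')
    _ = ‖a‖ := by rw [← Finset.sum_mul, sum_qwt_eq_one, one_mul]

/-- ★ `‖(Q′(U)a)(ι) − (Q(U)a)(ι)‖ ≤ 2ε‖a‖` when the transporters of `Q′` are those of `Q` re-based by rotations within `ε` of `1` on the support of `qK`.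
[cite: Balaban1985BackgroundPropagators, (3.12) p.392, (3.28) p.395] -/
theorem norm_QY_sub_QY_le (parB parB' : BondParY 𝔸 i) (U : CfgY 𝔸 i)
    (hunit : ∀ (ι : IBondY i) (f : FBondY i), qT i parB U ι f ∈ unitaryUnits 𝔸)
    (hunit' : ∀ (ι : IBondY i) (f : FBondY i), qT i parB' U ι f ∈ unitaryUnits 𝔸)
    {ε : ℝ} (hε : 0 ≤ ε) (hV : ∀ (ι : IBondY i) (f : FBondY i), qK i ι f ≠ 0 → ‖((qT i parB' U ι f * (qT i parB U ι f)⁻¹ : 𝔸ˣ) : 𝔸) - 1‖ ≤ ε)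
    (a : FBondY i → 𝔸) (ι : IBondY i) : ‖QY i parB' U a ι - QY i parB U a ι‖ ≤ 2 * ε * ‖a‖ := by
  classical
  rw [QY, QY, trLiftY_apply, trLiftY_apply, ← Finset.sum_sub_distrib]
  calc ‖∑ f', (((qK i ι f' : ℝ) : ℂ) • R (qT i parB' U ι f') (a f') - ((qK i ι f' : ℝ) : ℂ) • R (qT i parB U ι f') (a f'))‖
      ≤ ∑ f', ‖((qK i ι f' : ℝ) : ℂ) • R (qT i parB' U ι f') (a f') - ((qK i ι f' : ℝ) : ℂ) • R (qT i parB U ι f') (a f')‖ := norm_sum_le _ _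
    _ ≤ ∑ f', qwt i.hN i.D i.hk ι f' * (2 * ε * ‖a‖) := Finset.sum_le_sum fun f' _ => by
        rw [← smul_sub, norm_smul, Complex.norm_real, Real.norm_eq_abs, qK_apply, abs_of_nonneg (qwt_nonneg i.hN i.D i.hk ι f')]
        by_cases hq' : qK i ι f' = 0
        · rw [qK_apply] at hq'
          rw [hq', zero_mul, zero_mul]
        · refine mul_le_mul_of_nonneg_left ?_ (qwt_nonneg i.hN i.D i.hk ι f')
          have hVu : qT i parB' U ι f' * (qT i parB U ι f')⁻¹ ∈ unitaryUnits 𝔸 :=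
            (unitaryUnits 𝔸).mul_mem (hunit' ι f') ((unitaryUnits 𝔸).inv_mem (hunit ι f'))
          have hfac : qT i parB' U ι f' = qT i parB' U ι f' * (qT i parB U ι f')⁻¹ * qT i parB U ι f' := by rw [inv_mul_cancel_right]
          rw [hfac, B9Eq39Adjoint.R_mul]
          refine (norm_R_sub_self_le (unitaryUnits_le_U1 hVu) _).trans ?_
          have h1 := hV ι f' hq'
          have h2 : ‖R (qT i parB U ι f') (a f')‖ ≤ ‖a‖ := (norm_R_le_of_mem_unitaryUnits (hunit ι f') _).trans (norm_le_pi_norm a f')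
          calc 2 * ‖((qT i parB' U ι f' * (qT i parB U ι f')⁻¹ : 𝔸ˣ) : 𝔸) - 1‖ * ‖R (qT i parB U ι f') (a f')‖ ≤ 2 * ε * ‖a‖ := by gcongr
            _ = 2 * ε * ‖a‖ := rfl
    _ = 2 * ε * ‖a‖ := by rw [← Finset.sum_mul, sum_qwt_eq_one, one_mul]

/-- ★★ **ONE TERM OF THE SANDWICH UNDER RE-BASING**: with `T(ι,f) = qT parB U ι f`, `T′ = V·T` (`‖V_{ι,f} − 1‖ ≤ ε` on the support of `qK`), both unitary:
`‖R(T′(ι,f))⁻¹(w_ι·(Q′a)(ι)) − R(T(ι,f))⁻¹(w_ι·(Qa)(ι))‖ ≤ 4ε·w_ι·‖a‖`. [cite: Balaban1985BackgroundPropagators, (3.12)–(3.13) p.392, (3.16) p.393, (3.26) p.395] -/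
theorem norm_sandwich_term_sub_le (parB parB' : BondParY 𝔸 i) (U : CfgY 𝔸 i)
    (hunit : ∀ (ι : IBondY i) (f : FBondY i), qT i parB U ι f ∈ unitaryUnits 𝔸)
    (hunit' : ∀ (ι : IBondY i) (f : FBondY i), qT i parB' U ι f ∈ unitaryUnits 𝔸)
    {ε : ℝ} (hε : 0 ≤ ε) (hV : ∀ (ι : IBondY i) (f : FBondY i), qK i ι f ≠ 0 → ‖((qT i parB' U ι f * (qT i parB U ι f)⁻¹ : 𝔸ˣ) : 𝔸) - 1‖ ≤ ε)
    (hw0 : ∀ ι : IBondY i, 0 ≤ i.w ι) (a : FBondY i → 𝔸) (ι : IBondY i) (f : FBondY i) (hq : qK i ι f ≠ 0) :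
    ‖R (qT i parB' U ι f)⁻¹ (aY i (QY i parB' U a) ι) - R (qT i parB U ι f)⁻¹ (aY i (QY i parB U a) ι)‖ ≤ 4 * ε * i.w ι * ‖a‖ := by
  set P : 𝔸ˣ := qT i parB U ι f with hP
  set P' : 𝔸ˣ := qT i parB' U ι f with hP'
  set V : 𝔸ˣ := P' * P⁻¹ with hVdef
  have hVu : V ∈ unitaryUnits 𝔸 := (unitaryUnits 𝔸).mul_mem (hunit' ι f) ((unitaryUnits 𝔸).inv_mem (hunit ι f))
  have hVε : ‖(V : 𝔸) - 1‖ ≤ ε := hV ι f hq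
  have hVinvε : ‖((V⁻¹ : 𝔸ˣ) : 𝔸) - 1‖ ≤ ε := (norm_inv_sub_one_le (unitaryUnits_le_U1 hVu)).trans hVε
  have hP'inv : P'⁻¹ = P⁻¹ * V⁻¹ := by
    rw [show P' = V * P by rw [hVdef, inv_mul_cancel_right], mul_inv_rev]
  set Z : 𝔸 := aY i (QY i parB U a) ι with hZ
  set Z' : 𝔸 := aY i (QY i parB' U a) ι with hZ'
  have hZn : ‖Z‖ ≤ i.w ι * ‖a‖ := by
    rw [hZ, aY_apply, norm_smul, Complex.norm_real, Real.norm_of_nonneg (hw0 ι)]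
    exact mul_le_mul_of_nonneg_left (norm_QY_apply_le i parB U hunit a ι) (hw0 ι)
  have hZd : ‖Z' - Z‖ ≤ i.w ι * (2 * ε * ‖a‖) := by
    rw [hZ, hZ', aY_apply, aY_apply, ← smul_sub, norm_smul, Complex.norm_real, Real.norm_of_nonneg (hw0 ι)]
    exact mul_le_mul_of_nonneg_left (norm_QY_sub_QY_le i parB parB' U hunit hunit' hε hV a ι) (hw0 ι)
  rw [hP'inv, B9Eq39Adjoint.R_mul, ← R_sub]
  calc ‖R P⁻¹ (R V⁻¹ Z' - Z)‖ ≤ ‖R V⁻¹ Z' - Z‖ := norm_R_le_of_mem_unitaryUnits ((unitaryUnits 𝔸).inv_mem (hunit ι f)) _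
    _ = ‖R V⁻¹ (Z' - Z) + (R V⁻¹ Z - Z)‖ := by rw [R_sub]; abel_nf
    _ ≤ ‖R V⁻¹ (Z' - Z)‖ + ‖R V⁻¹ Z - Z‖ := norm_add_le _ _
    _ ≤ ‖Z' - Z‖ + 2 * ‖((V⁻¹ : 𝔸ˣ) : 𝔸) - 1‖ * ‖Z‖ :=
        add_le_add (norm_R_le_of_mem_unitaryUnits ((unitaryUnits 𝔸).inv_mem hVu) _) (norm_R_sub_self_le (unitaryUnits_le_U1 ((unitaryUnits 𝔸).inv_mem hVu)) Z)
    _ ≤ i.w ι * (2 * ε * ‖a‖) + 2 * ε * (i.w ι * ‖a‖) := by gcongr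
    _ = 4 * ε * i.w ι * ‖a‖ := by ring

/-- ★★ **THE SANDWICH UNDER AN `ε`-RE-BASING, PER FINE BOND**: at a member of constant level `n` with the `b₀ = 1` band weights, two transporter families with
unitary transporters related by `qT′ ι f = V_{ι,f}·qT ι f`, `‖V_{ι,f} − 1‖ ≤ ε` whenever `qK ι f ≠ 0`: for every bond function `a` and fine bond `f`,
`‖(Q*′(U)aQ′(U)a)(f) − (Q*(U)aQ(U)a)(f)‖ ≤ 8ε·c_f²·L^{−2n}·‖a‖` (two index bonds see `f`, each with `|qK|·w ≤ c_f²L^{−2n}`).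
[cite: Balaban1985BackgroundPropagators, (3.12)–(3.13) pp.392–393, (3.16) p.393, (3.26) p.395; Balaban1984PropagatorsI, (1.18) p.20] -/
theorem norm_sandwich_sub_le (hD : ∀ x, i.D.lev x = n) (hk : i.k = n + 1)
    (hw : ∀ ι : IBondY i, i.w ι = i.cf ^ 2 * (((((ℓ + 1 : ℕ) : ℝ)) ^ (ι.1.1 : ℕ)) ^ (d + 1) * (1 / (((ℓ + 1 : ℕ) : ℝ)) ^ (ι.1.1 : ℕ)) ^ 2))
    (parB parB' : BondParY 𝔸 i) (U : CfgY 𝔸 i)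
    (hunit : ∀ (ι : IBondY i) (f : FBondY i), qT i parB U ι f ∈ unitaryUnits 𝔸)
    (hunit' : ∀ (ι : IBondY i) (f : FBondY i), qT i parB' U ι f ∈ unitaryUnits 𝔸)
    {ε : ℝ} (hε : 0 ≤ ε) (hV : ∀ (ι : IBondY i) (f : FBondY i), qK i ι f ≠ 0 → ‖((qT i parB' U ι f * (qT i parB U ι f)⁻¹ : 𝔸ˣ) : 𝔸) - 1‖ ≤ ε)
    (a : FBondY i → 𝔸) (f : FBondY i) :
    ‖QsY i parB' U (aY i (QY i parB' U a)) f - QsY i parB U (aY i (QY i parB U a)) f‖ ≤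
      8 * ε * (i.cf ^ 2 * (((((ℓ + 1 : ℕ) : ℝ)) ^ n) ^ 2)⁻¹) * ‖a‖ := by
  classical
  set y : LSite (d + 1) := rel (0 : Site (PV d ℓ i.m i.K hd hL) 0) f.src with hydef
  set μ : Fin (d + 1) := f.dir with hμdef
  set N : ℝ := (((ℓ + 1 : ℕ) : ℝ)) ^ n with hNdef
  have hN0 : 0 < N := by positivity
  have hw0 : ∀ ι : IBondY i, 0 ≤ i.w ι := fun ι => by rw [hw ι]; positivity
  have e1 : ∀ (j j' : ℕ) (w : LSite (d + 1)), j = j' →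
      rel (0 : Site (PV d ℓ i.m i.K hd hL) j) (transl (0 : Site (PV d ℓ i.m i.K hd hL) j) w) =
        rel (0 : Site (PV d ℓ i.m i.K hd hL) j') (transl (0 : Site (PV d ℓ i.m i.K hd hL) j') w) := by
    rintro j j' w rfl; rfl
  -- the two index bonds over the window bonds of direction `μ`
  choose ιOf hlev hsrc hdir using fun (t : Fin 2) => exists_ibondY_of_constLev i hD hk (winBase (ℓ + 1) n y μ t) μ
  have hsupp : ∀ ι : IBondY i, qK i ι f ≠ 0 → ι ∈ Finset.image ιOf Finset.univ := by
    intro ι hι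
    obtain ⟨t, ht⟩ := src_eq_winBase_of_qK_ne_zero i hι
    have hdι := dir_eq_of_qK_ne_zero i hι
    have hlι := ibondY_level_eq i hD hk ι
    have hwb : winBase (ℓ + 1) ((ι.1.1 : ℕ)) (rel (0 : Site (PV d ℓ i.m i.K hd hL) 0) f.src) f.dir t = winBase (ℓ + 1) n y μ t := by
      rw [hlι]
    refine Finset.mem_image.2 ⟨t, Finset.mem_univ _, (ibondY_eq_of_key_eq i ?_ ?_ ?_).symm⟩
    · rw [hlι, hlev t]
    · rw [ht, hsrc t, hwb]
      exact e1 _ _ _ (hlι.trans (hlev t).symm)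
    · rw [hdι, hdir t]
  have hinj : Function.Injective ιOf := by
    intro t t' htt
    have ha := hsrc t
    have hb := hsrc t'
    have hkey : rel (0 : Site (PV d ℓ i.m i.K hd hL) ((ιOf t).1.1 : ℕ)) (ιOf t).1.2.src =
        rel (0 : Site (PV d ℓ i.m i.K hd hL) ((ιOf t').1.1 : ℕ)) (ιOf t').1.2.src := by rw [htt]
    rw [ha, hb, e1 _ n _ (hlev t), e1 _ n _ (hlev t')] at hkey
    have htr := congrArg (transl (0 : Site (PV d ℓ i.m i.K hd hL) n)) hkey
    rw [transl_rel, transl_rel] at htr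
    exact transl_winBase_injective (d := d) (hd := hd) (hL := hL) y μ htr
  -- the difference as a sum over index bonds
  set D : IBondY i → 𝔸 := fun ι => R (qT i parB' U ι f)⁻¹ (aY i (QY i parB' U a) ι) - R (qT i parB U ι f)⁻¹ (aY i (QY i parB U a) ι) with hDdef
  have hdiff : QsY i parB' U (aY i (QY i parB' U a)) f - QsY i parB U (aY i (QY i parB U a)) f = ∑ ι, ((qK i ι f : ℝ) : ℂ) • D ι := by
    rw [QsY_apply, QsY_apply, ← Finset.sum_sub_distrib]
    refine Finset.sum_congr rfl fun ι _ => ?_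
    rw [hDdef, smul_sub]
  -- per index bond
  have hterm : ∀ ι, ‖((qK i ι f : ℝ) : ℂ) • D ι‖ ≤ |qK i ι f| * (4 * ε * i.w ι * ‖a‖) := fun ι => by
    rw [norm_smul, Complex.norm_real, Real.norm_eq_abs]
    by_cases hq : qK i ι f = 0
    · rw [hq, abs_zero, zero_mul, zero_mul]
    · exact mul_le_mul_of_nonneg_left (norm_sandwich_term_sub_le i parB parB' U hunit hunit' hε hV hw0 a ι f hq) (abs_nonneg _)
  -- restrict to the two window index bonds
  have hsum : ∑ ι, |qK i ι f| * (4 * ε * i.w ι * ‖a‖) = ∑ t : Fin 2, |qK i (ιOf t) f| * (4 * ε * i.w (ιOf t) * ‖a‖) := by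
    rw [← Finset.sum_subset (Finset.subset_univ (Finset.image ιOf Finset.univ))
      (fun ι _ hι => by
        have hq : qK i ι f = 0 := by by_contra hne; exact hι (hsupp ι hne)
        rw [hq, abs_zero, zero_mul]),
      Finset.sum_image (fun t _ t' _ h => hinj h)]
  -- the entry scale: `|qK ι f|·w_ι ≤ c_f²·N⁻²`
  have hqw : ∀ t : Fin 2, |qK i (ιOf t) f| * i.w (ιOf t) ≤ i.cf ^ 2 * (N ^ 2)⁻¹ := fun t => by
    rw [qK_apply, abs_of_nonneg (qwt_nonneg i.hN i.D i.hk _ f), hw (ιOf t), hlev t]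
    have h := qwt_le i.hN i.D i.hk (ιOf t) f
    have hl : B6Ineq2142KLevelV1.lvl i.hN i.D i.hk (ιOf t) = n := hlev t
    rw [hl] at h
    have hpow : ((((ℓ + 1 : ℕ) : ℝ)) ^ (d + 1)) ^ n = N ^ (d + 1) := by rw [hNdef, ← pow_mul, ← pow_mul, mul_comm]
    rw [hpow] at h
    have hNd : 0 < N ^ (d + 1) := by positivity
    calc qwt i.hN i.D i.hk (ιOf t) f * (i.cf ^ 2 * (N ^ (d + 1) * (1 / N) ^ 2))
        ≤ (N ^ (d + 1))⁻¹ * (i.cf ^ 2 * (N ^ (d + 1) * (1 / N) ^ 2)) := mul_le_mul_of_nonneg_right h (by positivity)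
      _ = i.cf ^ 2 * (N ^ 2)⁻¹ := by field_simp
  rw [hdiff]
  calc ‖∑ ι, ((qK i ι f : ℝ) : ℂ) • D ι‖ ≤ ∑ ι, ‖((qK i ι f : ℝ) : ℂ) • D ι‖ := norm_sum_le _ _
    _ ≤ ∑ ι, |qK i ι f| * (4 * ε * i.w ι * ‖a‖) := Finset.sum_le_sum fun ι _ => hterm ι
    _ = ∑ t : Fin 2, |qK i (ιOf t) f| * (4 * ε * i.w (ιOf t) * ‖a‖) := hsum
    _ = ∑ t : Fin 2, (|qK i (ιOf t) f| * i.w (ιOf t)) * (4 * ε * ‖a‖) := Finset.sum_congr rfl fun t _ => by ring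
    _ ≤ ∑ t : Fin 2, (i.cf ^ 2 * (N ^ 2)⁻¹) * (4 * ε * ‖a‖) := Finset.sum_le_sum fun t _ => mul_le_mul_of_nonneg_right (hqw t) (by positivity)
    _ = 8 * ε * (i.cf ^ 2 * (N ^ 2)⁻¹) * ‖a‖ := by
        rw [Finset.sum_const, Finset.card_univ, Fintype.card_fin]
        simp only [nsmul_eq_mul]
        push_cast
        ring

end Perturb

/-! ## §5 `hQQ` at print's centre-taxicab family `parBY`, per background -/

section Centre

variable {𝔸 : Type} [CStarAlgebra 𝔸] [Nontrivial 𝔸] [FiniteDimensional ℝ 𝔸] (τ : 𝔸 →ₗ[ℂ] ℂ) (i : KIdx d ℓ hd hL b₀ b₁) {n : ℕ}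

/-- ★★★ **`hQQ` AT PRINT's TRANSPORTERS, PER BACKGROUND.**  At a member of constant level `n` (nominal index `n + 1`, every site of level `n`, `b₀ = 1` band
weights), for a faithful tracial `τ` with `|Re τ(x*y)| ≤ C_τ‖x‖‖y‖` and a unitary, `N₀`-periodic background `U₀ ∈ Reg17 L n ℤ^{d+1} α` with `0 < α ≤ α_Q∕L²`:
def-Y's genuine averaging sandwich at print's centre-taxicab transporter family `parBY` ([4] (3.12): «U(Γ_{y,x}), Γ a contour from the centre y of the block to x»,
(3.40): «a shortest contour») and the member's background `U = bgY i U₀` satisfies, for EVERY bond function `a`,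
`|Q*(U)aQ(U)a − (c_fη)²·(QQZdP(U₀)a♯)♭|₍₋₃₎ ≤ ε_Q·|a|₍₋₁₎`,
`ε_Q = (w₋₃∕w₋₁)·(32(d+2)²·c_f²L^{−2n}·α + (c_fη)²·w_n·2(d+1)·C_τβ_τ·6(d+1)·K₁·η·Lⁿ·LⁿL^{−n(d+1)}·α)`, `K₁ = 13344(d+1)(d+2)²(d+5)L^{d+4}` — the corner-tree
`hQQ` of F3 (`hQQ_cornerTree_bgY`), moved EXACTLY to the centre-re-based corner family (F3 §5 `QsY_aY_QY_rebase`), then to `parBY` by the `O(α)` loop of §3 and the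
perturbation lemma of §4.  This is the last conjunct (`hQQ`) of `B9B8KnitTorusSocketBetaZero.sockB9P3Per_torusIdx_of_sectors₀`'s binder `hY` at `parB = parBY i`,
linear in `α` (a fortiori for Hermitian `a`).
[cite: Balaban1985BackgroundPropagators, (3.12)–(3.13) pp.392–393, (3.16) p.393, (3.26) p.395, (3.40)–(3.41) p.397; Balaban1985RegularSpaces, (1.58)–(1.59) p.86, p.77 («Ω_j = T_η»); Balaban1985Averaging, (139)–(147) pp.39–40, pp.24–25] -/
theorem hQQ_parBY_bgY (hτp : ∀ a : 𝔸, a ≠ 0 → 0 < (τ (star a * a)).re) (hτt : ∀ a b : 𝔸, τ (a * b) = τ (b * a))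
    {Cτ : ℝ} (hCτ : ∀ x y : 𝔸, |(τ (star x * y)).re| ≤ Cτ * ‖x‖ * ‖y‖)
    (hD : ∀ x, i.D.lev x = n) (hk : i.k = n + 1) (hlev : ∀ z : SiteY i, levY i z = n)
    (hw : ∀ ι : IBondY i, i.w ι = i.cf ^ 2 * (((((ℓ + 1 : ℕ) : ℝ)) ^ (ι.1.1 : ℕ)) ^ (d + 1) * (1 / (((ℓ + 1 : ℕ) : ℝ)) ^ (ι.1.1 : ℕ)) ^ 2))
    (hL1 : 1 ≤ ℓ + 1) {η : ℝ} (hη : 0 < η) {k : ℕ} (hk1 : 1 ≤ k)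
    {α : ℝ} (hα : 0 < α) (hαQ : α ≤ alphaQ (d + 1) (ℓ + 1) / ((ℓ + 1 : ℕ) : ℝ) ^ 2)
    {U₀ : LSite (d + 1) → Fin (d + 1) → 𝔸ˣ} (hU₀ : ∀ x κ, U₀ x κ ∈ unitaryUnits 𝔸)
    (hper : IsPeriodic ((PV d ℓ i.m i.K hd hL).sitesPerDir 0) U₀)
    (hreg : Reg17 (ℓ + 1) n (fun _ => (Set.univ : Set (LSite (d + 1)))) α U₀) (a : FBondY i → 𝔸) :
    wNormBY i (-3) (QsY i (parBY i) (bgY i U₀) (aY i (QY i (parBY i) (bgY i U₀) a)) -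
        ((i.cf * η) ^ 2 : ℝ) • descBd i (QQZdP τ (ℓ + 1) (fun m' => torusLamb (d := d + 1) m') (torusIdx (d := d + 1) hL1 ⟨η, hη, k, hk1⟩) n
          U₀ (liftBd i a))) ≤
      (weight (ℓ + 1) |i.cf|⁻¹ (-3) n / weight (ℓ + 1) |i.cf|⁻¹ (-1) n *
        (8 * (4 * ((d : ℝ) + 2) ^ 2 * α) * (i.cf ^ 2 * (((((ℓ + 1 : ℕ) : ℝ)) ^ n) ^ 2)⁻¹) +
          (i.cf * η) ^ 2 * wQ (d := d + 1) (ℓ + 1) η n *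
            (2 * ((d : ℝ) + 1) * (Cτ * betaTau τ *
              (6 * ((d : ℝ) + 1) * (13344 * ((d : ℝ) + 1) * ((d : ℝ) + 2) ^ 2 * ((d : ℝ) + 5) * (((ℓ + 1 : ℕ) : ℝ)) ^ (d + 4)) * η *
                (((ℓ + 1 : ℕ) : ℝ)) ^ n * ((((ℓ + 1 : ℕ) : ℝ)) ^ n * (((((ℓ + 1 : ℕ) : ℝ)) ^ (d + 1)) ^ n)⁻¹) * α))))) * wNormBY i (-1) a := by
  classical
  -- the corner-tree family `C` and its exact centre re-basing `S`
  set PC : BondParY 𝔸 i := (fun (V : CfgY 𝔸 i) (s s' : Site (PV d ℓ i.m i.K hd hL) 0) =>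
        hol (liftCfg V)
          (rel (0 : Site (PV d ℓ i.m i.K hd hL) 0) s' -
            fun ν => ((((s' ν - s ν + ((((ℓ + 1) ^ n - 1) / 2 : ℕ) : ZMod ((PV d ℓ i.m i.K hd hL).sitesPerDir 0))).val : ℕ) : ℤ)))
          (treeWord fun ν => ((((s' ν - s ν + ((((ℓ + 1) ^ n - 1) / 2 : ℕ) : ZMod ((PV d ℓ i.m i.K hd hL).sitesPerDir 0))).val : ℕ) : ℤ)))) with hPC
  set PS : BondParY 𝔸 i := fun (V : CfgY 𝔸 i) (s s' : Site (PV d ℓ i.m i.K hd hL) 0) =>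
    parTaxiV V s (fun ν => s ν - ((((ℓ + 1) ^ n - 1) / 2 : ℕ) : ZMod ((PV d ℓ i.m i.K hd hL).sitesPerDir 0))) * PC V s s' with hPS
  have hunitY : ∀ (ι : IBondY i) (f : FBondY i), qT i (parBY i) (bgY i U₀) ι f ∈ unitaryUnits 𝔸 := fun ι f =>
    parTaxiV_mem (bgY_mem i hU₀) _ _
  have hunitC : ∀ (ι : IBondY i) (f : FBondY i), qT i PC (bgY i U₀) ι f ∈ unitaryUnits 𝔸 := fun ι f =>
    qT_cornerTree_mem i (bgY_mem i hU₀) ι f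
  have hunitS : ∀ (ι : IBondY i) (f : FBondY i), qT i PS (bgY i U₀) ι f ∈ unitaryUnits 𝔸 := fun ι f =>
    (unitaryUnits 𝔸).mul_mem (parTaxiV_mem (bgY_mem i hU₀) _ _) (hunitC ι f)
  -- `S` is an exact re-basing of `C`: the sandwiches coincide
  have hSC : QsY i PS (bgY i U₀) (aY i (QY i PS (bgY i U₀) a)) = QsY i PC (bgY i U₀) (aY i (QY i PC (bgY i U₀) a)) :=
    QsY_aY_QY_rebase i PC PS (bgY i U₀)
      (fun ι => parTaxiV (bgY i U₀) (embIter (ι.1.1 : ℕ) ι.1.2.src)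
        (fun ν => embIter (ι.1.1 : ℕ) ι.1.2.src ν - ((((ℓ + 1) ^ n - 1) / 2 : ℕ) : ZMod ((PV d ℓ i.m i.K hd hL).sitesPerDir 0))))
      (fun _ _ => rfl) a
  -- `Y = parBY` is a `4(d+2)²α`-re-basing of `S`
  have hV : ∀ (ι : IBondY i) (f : FBondY i), qK i ι f ≠ 0 →
      ‖((qT i (parBY i) (bgY i U₀) ι f * (qT i PS (bgY i U₀) ι f)⁻¹ : 𝔸ˣ) : 𝔸) - 1‖ ≤ 4 * ((d : ℝ) + 2) ^ 2 * α := fun ι f hq =>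
    norm_qT_parBY_rebase_sub_one_le i hD hk hα hU₀ hper hreg ι f hq
  have hpert : ∀ f : FBondY i, ‖QsY i (parBY i) (bgY i U₀) (aY i (QY i (parBY i) (bgY i U₀) a)) f - QsY i PS (bgY i U₀) (aY i (QY i PS (bgY i U₀) a)) f‖ ≤
      8 * (4 * ((d : ℝ) + 2) ^ 2 * α) * (i.cf ^ 2 * (((((ℓ + 1 : ℕ) : ℝ)) ^ n) ^ 2)⁻¹) * ‖a‖ := fun f =>
    norm_sandwich_sub_le i hD hk hw PS (parBY i) (bgY i U₀) hunitS hunitY (by positivity) hV a f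
  -- F3 at the corner-tree family
  have hC := hQQ_cornerTree_bgY τ i hτp hτt hCτ hD hk hlev hw hL1 hη hk1 hα hαQ hU₀ hper hreg a
  -- bookkeeping
  set X := ((i.cf * η) ^ 2 : ℝ) • descBd i (QQZdP τ (ℓ + 1) (fun m' => torusLamb (d := d + 1) m') (torusIdx (d := d + 1) hL1 ⟨η, hη, k, hk1⟩) n
    U₀ (liftBd i a)) with hX
  set SY := QsY i (parBY i) (bgY i U₀) (aY i (QY i (parBY i) (bgY i U₀) a)) with hSY
  set SS := QsY i PS (bgY i U₀) (aY i (QY i PS (bgY i U₀) a)) with hSS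
  set SCt := QsY i PC (bgY i U₀) (aY i (QY i PC (bgY i U₀) a)) with hSCt
  set A : ℝ := 8 * (4 * ((d : ℝ) + 2) ^ 2 * α) * (i.cf ^ 2 * (((((ℓ + 1 : ℕ) : ℝ)) ^ n) ^ 2)⁻¹) with hA
  set B : ℝ := (i.cf * η) ^ 2 * wQ (d := d + 1) (ℓ + 1) η n *
    (2 * ((d : ℝ) + 1) * (Cτ * betaTau τ *
      (6 * ((d : ℝ) + 1) * (13344 * ((d : ℝ) + 1) * ((d : ℝ) + 2) ^ 2 * ((d : ℝ) + 5) * (((ℓ + 1 : ℕ) : ℝ)) ^ (d + 4)) * η *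
        (((ℓ + 1 : ℕ) : ℝ)) ^ n * ((((ℓ + 1 : ℕ) : ℝ)) ^ n * (((((ℓ + 1 : ℕ) : ℝ)) ^ (d + 1)) ^ n)⁻¹) * α))) with hB
  set w₁ : ℝ := weight (ℓ + 1) |i.cf|⁻¹ (-1) n with hw₁def
  set w₃ : ℝ := weight (ℓ + 1) |i.cf|⁻¹ (-3) n with hw₃def
  have hw₁ : 0 < w₁ := weight_level_pos i (-1 : ℝ) n
  have hw₃ : 0 < w₃ := weight_level_pos i (-3 : ℝ) n
  have hEY : SY - X = (SY - SS) + (SCt - X) := by rw [hSC]; abel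
  have hA0 : 0 ≤ A * ‖a‖ := by positivity
  have hΔ : ‖SY - SS‖ ≤ A * ‖a‖ := (pi_norm_le_iff_of_nonneg hA0).2 fun f => by
    rw [Pi.sub_apply]; exact hpert f
  simp only [wNormBY_eq_weight_mul_norm i hlev] at hC ⊢
  have htri : ‖SY - X‖ ≤ ‖SY - SS‖ + ‖SCt - X‖ := by rw [hEY]; exact norm_add_le _ _
  have hAw : w₃ * ‖SY - SS‖ ≤ w₃ / w₁ * A * (w₁ * ‖a‖) := by
    calc w₃ * ‖SY - SS‖ ≤ w₃ * (A * ‖a‖) := mul_le_mul_of_nonneg_left hΔ hw₃.le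
      _ = w₃ / w₁ * A * (w₁ * ‖a‖) := by field_simp
  calc w₃ * ‖SY - X‖ ≤ w₃ * (‖SY - SS‖ + ‖SCt - X‖) := mul_le_mul_of_nonneg_left htri hw₃.le
    _ = w₃ * ‖SY - SS‖ + w₃ * ‖SCt - X‖ := mul_add _ _ _
    _ ≤ w₃ / w₁ * A * (w₁ * ‖a‖) + w₃ / w₁ * B * (w₁ * ‖a‖) := add_le_add hAw hC
    _ = w₃ / w₁ * (A + B) * (w₁ * ‖a‖) := by ring

end Centre

/-! ## §6 The socket's binder shape: from `InAk` at any `α₀ ≤ a_T ≤ α_Q∕L²` -/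

section Socket

variable {𝔸 : Type} [CStarAlgebra 𝔸] [Nontrivial 𝔸] [FiniteDimensional ℝ 𝔸] (τ : 𝔸 →ₗ[ℂ] ℂ) (i : KIdx d ℓ hd hL b₀ b₁) {n : ℕ}

/-- ★★★ **THE `hQQ` CONJUNCT OF THE TORUS SOCKET's BINDER, AS DISPLAYED.**  Same member and `τ`; fix a threshold `a_T` with `0 < a_T ≤ α_Q∕L²`.  Then for EVERY
`α₀ ∈ (0, a_T]` and every unitary `N₀`-periodic background `U₀ ∈ 𝔄_n(ℤ^{d+1}, α₀)` (`InAk`, [B8] (1.7)–(1.8)), with `U = bgY i U₀`, `parB = parBY i`: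
`∀ a, |Q*(U)aQ(U)a − (c_fη)²·(QQZdP(U₀)a♯)♭|₍₋₃₎ ≤ ε_Q(a_T)·|a|₍₋₁₎` with the `ε_Q` of `hQQ_parBY_bgY` at `α = a_T` — uniform in `α₀` and `U₀`, i.e. literally the
last conjunct of `B9B8KnitTorusSocketBetaZero.sockB9P3Per_torusIdx_of_sectors₀`'s hypothesis `hY` (there asked for Hermitian `a` only).
[cite: Balaban1985RegularSpaces, (1.7)–(1.8) p.77, (1.58)–(1.59) p.86; Balaban1985BackgroundPropagators, (3.12) p.392, (3.16) p.393, (3.26) p.395, (3.41) p.397] -/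
theorem hQQ_parBY_of_inAk (hτp : ∀ a : 𝔸, a ≠ 0 → 0 < (τ (star a * a)).re) (hτt : ∀ a b : 𝔸, τ (a * b) = τ (b * a))
    {Cτ : ℝ} (hCτ : ∀ x y : 𝔸, |(τ (star x * y)).re| ≤ Cτ * ‖x‖ * ‖y‖)
    (hD : ∀ x, i.D.lev x = n) (hk : i.k = n + 1) (hlev : ∀ z : SiteY i, levY i z = n)
    (hw : ∀ ι : IBondY i, i.w ι = i.cf ^ 2 * (((((ℓ + 1 : ℕ) : ℝ)) ^ (ι.1.1 : ℕ)) ^ (d + 1) * (1 / (((ℓ + 1 : ℕ) : ℝ)) ^ (ι.1.1 : ℕ)) ^ 2))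
    (hL1 : 1 ≤ ℓ + 1) {η : ℝ} (hη : 0 < η) {k : ℕ} (hk1 : 1 ≤ k)
    {aT : ℝ} (haT : 0 < aT) (haTQ : aT ≤ alphaQ (d + 1) (ℓ + 1) / ((ℓ + 1 : ℕ) : ℝ) ^ 2)
    {α₀ : ℝ} (U₀ : LSite (d + 1) → Fin (d + 1) → 𝔸ˣ) (hU₀ : ∀ x κ, U₀ x κ ∈ unitaryUnits 𝔸)
    (hper : IsPeriodic ((PV d ℓ i.m i.K hd hL).sitesPerDir 0) U₀) (hα₀T : α₀ ≤ aT)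
    (hAk : InAk (ℓ + 1) n η α₀ (fun _ => (Set.univ : Set (LSite (d + 1)))) U₀) (a : FBondY i → 𝔸) :
    wNormBY i (-3) (QsY i (parBY i) (bgY i U₀) (aY i (QY i (parBY i) (bgY i U₀) a)) -
        ((i.cf * η) ^ 2 : ℝ) • descBd i (QQZdP τ (ℓ + 1) (fun m' => torusLamb (d := d + 1) m') (torusIdx (d := d + 1) hL1 ⟨η, hη, k, hk1⟩) n
          U₀ (liftBd i a))) ≤
      (weight (ℓ + 1) |i.cf|⁻¹ (-3) n / weight (ℓ + 1) |i.cf|⁻¹ (-1) n *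
        (8 * (4 * ((d : ℝ) + 2) ^ 2 * aT) * (i.cf ^ 2 * (((((ℓ + 1 : ℕ) : ℝ)) ^ n) ^ 2)⁻¹) +
          (i.cf * η) ^ 2 * wQ (d := d + 1) (ℓ + 1) η n *
            (2 * ((d : ℝ) + 1) * (Cτ * betaTau τ *
              (6 * ((d : ℝ) + 1) * (13344 * ((d : ℝ) + 1) * ((d : ℝ) + 2) ^ 2 * ((d : ℝ) + 5) * (((ℓ + 1 : ℕ) : ℝ)) ^ (d + 4)) * η *
                (((ℓ + 1 : ℕ) : ℝ)) ^ n * ((((ℓ + 1 : ℕ) : ℝ)) ^ n * (((((ℓ + 1 : ℕ) : ℝ)) ^ (d + 1)) ^ n)⁻¹) * aT))))) * wNormBY i (-1) a :=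
  hQQ_parBY_bgY τ i hτp hτt hCτ hD hk hlev hw hL1 hη hk1 haT haTQ hU₀ hper (reg17_mono hα₀T (reg17_of_inAk hAk le_rfl)) a

end Socket

end Literature.MathematicalPhysics.QuantumFieldTheory.Balaban1983to89.B9B8KnitAveragingClosenessAtCentre
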